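import Mathlib
import Literature.Probability.Percolation.DiagonalStripHyperplaneRecursion
import Literature.Probability.Percolation.DiagonalStripQKZPinning
import Literature.Probability.Percolation.DiagonalStripPairingSymmetry
import HarnessLib

/-!
# The recursion of the left-passage pairing on `H_1` (IP12 Prop. 4.3, normalisation-free)

Topic `Literature/Probability/Percolation`. Ikhlef–Ponsaing (J. Stat. Phys. 149 (2012),
arXiv:1202.5476) Prop. 4.3: the left-passage numerator restricted to `z_2 = q z_1` is the numerator
of the system with two sites fewer, in the variables `ẑ`. We prove the normalisation-free version
for the pairing `N(ψ)/(Z(ψ) · ι Z(ψ))` built in `DiagonalStripPairingSymmetry` from a primitive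
polynomial ground state `P` at width `n+1` with the exact exchange relation at level `1`, and a
primitive polynomial ground state `P''` at width `n`:

* `ipTransferMatrixW_congr_z` — `t(w; z)` only depends on `z_1, …, z_{2m+1}`;
* `primitive_fixed_degreeOf_eq_zero` — a primitive polynomial ground state involves only
  `X_0, …, X_{2m+1}` (swap a large index with a fresh one: `t` is unchanged, so by generic
  simplicity the swapped vector is a constant multiple);
* `genHat` (`Ĥ`, the field extension of `hatRename`), `lamTwo`/`lamOne` (the restriction maps
  `Λ₂`, `Λ = Λ₂ ∘ σ_1` of the transposed side to `H_1`), with `Λ ∘ η = Λ` (`lamOne_hypSubst`) and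
  `Λ ∘ ẑ = Ĥ ∘ ι''` on polynomials in `X_0, …, X_{2n+1}` (`lamOne_hatRename`);
* `ipJunction_cpInsDup_zero` — `J(φ_1 R', φ_1 R) = J''(R', R)` (contracting the duplicated site),
  `ipJunction_right_cpInsDup_zero` — `J(lump (e_1 Q), φ_1 R) = J(Q, φ_1 R)`;
* `lamTwo_push_eq_lamOne` — the exact exchange relation at level `1` through `Λ₂`:
  `Λ₂(e_1 P) = Λ(P)`;
* **`pairing_recursion_H1`** — with `N_H = Σ Λ₂(P_Q) η(P_{Q'}) [J(Q,Q')]`, `Z_H = Σ η(P_Q)`,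
  `Z^ι_H = Σ Λ₂(P_Q)`: `N_H · Ĥ(Z'' · ι''Z'') = Ĥ(N'') · Z_H · Z^ι_H`, i.e. `P|_{H_1} = Ĥ(P'')` for
  `P = N/(Z ιZ)` — from the recursion up to scalar (`groundState_hyp_recursion_odd`), its
  `Λ`-transport, the `e_1`-regrouping and the two junction lemmas. The unknown scalar of the
  recursion CANCELS, so neither IP12 (25)'s scalar nor any degree statement is needed here.

## References

* Y. Ikhlef, A. K. Ponsaing, *Finite-size left-passage probability in percolation*, J. Stat. Phys.
  149 (2012) 10–36, arXiv:1202.5476, Props. 4.1, 4.3. [IkhlefPonsaing2012]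
-/

namespace Literature.Probability.Percolation

open Finset Literature.Probability.LatticeModels Literature.Probability.LatticeModels.TemperleyLieb

/-! ### The transfer matrix only sees the rapidities `z_1, …, z_L` -/

section CongrZ

variable {K : Type*} [Field K] {m : ℕ}

/-- Edges of the two layers have top level at most `2m+1`. [folklore] -/
theorem edgeTopLevel_le_of_mem {c : ℤ} (hc : c = 0 ∨ c = 1) {e : Sym2 (Site 2)} (he : e ∈ latticeLayer m c) :
    (edgeTopLevel e).toNat ≤ 2 * m + 1 := by
  rw [latticeLayer_eq_image, Finset.mem_image] at he
  obtain ⟨⟨i, j⟩, -, rfl⟩ := he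
  rw [edgeTopLevel_mk_colSite]
  have hi := i.2; have hj := j.2
  rcases hc with rfl | rfl <;> simp <;> omega

/-- **`t(w; z⃗)` depends only on `z_1, …, z_{2m+1}`.** [folklore] -/
theorem ipTransferMatrixW_congr_z (q w : K) {z z' : ℕ → K} (h : ∀ k, 1 ≤ k → k ≤ 2 * m + 1 → z k = z' k)
    (Q Q' : ColPattern m) : ipTransferMatrixW m q w z Q Q' = ipTransferMatrixW m q w z' Q Q' := by
  rw [ipTransferMatrixW_eq, ipTransferMatrixW_eq]
  refine ipTwoLayerW_congr' (fun e he => ?_) (fun e he => ?_) Q Q'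
  · unfold ipRowWeight
    rw [h _ (one_le_edgeTopLevel_of_mem (Or.inl rfl) he) (edgeTopLevel_le_of_mem (Or.inl rfl) he)]
  · unfold ipRowWeight
    rw [h _ (one_le_edgeTopLevel_of_mem (Or.inr rfl) he) (edgeTopLevel_le_of_mem (Or.inr rfl) he)]

end CongrZ

/-! ### A primitive ground state involves only the variables `X_0, …, X_L` -/

section Vars

open MvPolynomial

variable {m : ℕ}

/-- The rename automorphism of the rapidity field along a permutation of the indices. [folklore] -/
noncomputable def genRename (e : Equiv.Perm ℕ) : RapidityField ℂ ≃+* RapidityField ℂ :=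
  IsFractionRing.ringEquivOfRingEquiv (renameEquiv ℂ e).toRingEquiv

/-- `genRename` on polynomials. [folklore] -/
theorem genRename_toRF (e : Equiv.Perm ℕ) (f : MvPolynomial ℕ ℂ) : genRename e (toRF ℂ f) = toRF ℂ (rename e f) :=
  IsFractionRing.ringEquivOfRingEquiv_algebraMap _ f

/-- **A primitive polynomial ground state has no variable beyond `X_{2m+1}`.** (Swapping a large
index with a fresh one leaves `t` invariant, so the swapped vector is a constant multiple.)
[folklore] -/
theorem primitive_fixed_degreeOf_eq_zero {q : ℂ} (hq : q ^ 2 + q + 1 = 0) {P : ColPattern m → MvPolynomial ℕ ℂ}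
    (hprim : PolyPrimitive P)
    (hP : ∀ Q', ∑ Q, ipTransferMatrixW m (genC ℂ q) (genW ℂ) (genZ ℂ) Q Q' * toRF ℂ (P Q) = toRF ℂ (P Q'))
    {k : ℕ} (hk : 2 * m + 1 < k) (Q : ColPattern m) : (P Q).degreeOf k = 0 := by
  classical
  -- a fresh index
  set k' : ℕ := (Finset.univ.sup fun Q => ((P Q).vars.sup id)) + k + 1 with hk'
  have hk'fresh : ∀ Q, (P Q).degreeOf k' = 0 := by
    intro Q
    by_contra h
    have hmem : k' ∈ (P Q).vars := mem_vars_iff_degreeOf_ne_zero.2 h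
    have h1 : k' ≤ (P Q).vars.sup id := Finset.le_sup (f := id) hmem
    have h2 : (P Q).vars.sup id ≤ Finset.univ.sup fun Q => ((P Q).vars.sup id) :=
      Finset.le_sup (f := fun Q => ((P Q).vars.sup id)) (Finset.mem_univ Q)
    omega
  have hkk' : k ≠ k' := by omega
  set e := Equiv.swap k k' with he
  -- the swapped vector is fixed
  have hfix : ∀ Q', ∑ Q, ipTransferMatrixW m (genC ℂ q) (genW ℂ) (genZ ℂ) Q Q' * genRename e (toRF ℂ (P Q)) =
      genRename e (toRF ℂ (P Q')) := by
    intro Q'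
    rw [← hP Q', map_sum]
    refine Finset.sum_congr rfl fun Q _ => ?_
    rw [map_mul]
    congr 1
    rw [show (genRename e : RapidityField ℂ → RapidityField ℂ) = (genRename e).toRingHom from rfl, map_ipTransferMatrixW]
    simp only [RingEquiv.toRingHom_eq_coe, RingEquiv.coe_toRingHom]
    have hC : genRename e (genC ℂ q) = genC ℂ q := by
      rw [show genC ℂ q = toRF ℂ (C q) from rfl, genRename_toRF, rename_C]
    have hX : ∀ n, genRename e (genZ ℂ n) = genZ ℂ (e n) := fun n => by
      rw [show genZ ℂ n = toRF ℂ (X n) from rfl, genRename_toRF, rename_X]; rfl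
    have hW : genRename e (genW ℂ) = genW ℂ := by
      rw [show genW ℂ = genZ ℂ 0 from rfl, hX, he, Equiv.swap_apply_of_ne_of_ne (by omega) (by omega)]
    rw [hC, hW]
    refine (ipTransferMatrixW_congr_z _ _ (fun n hn1 hnL => ?_) Q Q').symm
    rw [Function.comp_apply, hX, he, Equiv.swap_apply_of_ne_of_ne (by omega) (by omega)]
  simp only [genRename_toRF] at hfix
  -- hence proportional to `P`, by a constant
  have hP0 : (fun Q => toRF ℂ (P Q)) ≠ 0 := by
    obtain ⟨Q₀, hQ₀⟩ := hprim.exists_ne_zero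
    intro h; exact hQ₀ (toRF_injective ((congrFun h Q₀).trans (map_zero _).symm))
  obtain ⟨c, hc⟩ := exists_scalar_of_proportional (fun k'' => ipTransferMatrixW_fixed_proportional hq hP hfix k'') hP0
  obtain ⟨C₀, rfl⟩ := hprim.exists_eq_toRF (c := c) fun Q => ⟨_, (hc Q).symm⟩
  obtain ⟨Q₀, hQ₀⟩ := hprim.exists_ne_zero
  have hee : ∀ f : MvPolynomial ℕ ℂ, rename e (rename e f) = f := fun f => by
    rw [rename_rename, show ((e : ℕ → ℕ) ∘ (e : ℕ → ℕ)) = id from funext fun n => Equiv.swap_apply_self _ _ _,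
      rename_id]
    rfl
  have hsq : rename e C₀ * C₀ = 1 := by
    have h1 := hc Q₀
    have h2 : toRF ℂ (P Q₀) = toRF ℂ (rename e C₀) * (toRF ℂ C₀ * toRF ℂ (P Q₀)) := by
      have := congrArg (genRename e) h1
      rw [genRename_toRF, map_mul, genRename_toRF, genRename_toRF, hee, h1] at this
      exact this
    have h3 : toRF ℂ ((rename e C₀ * C₀ - 1) * P Q₀) = 0 := by
      rw [map_mul, map_sub, map_mul, map_one]; linear_combination -h2
    have h4 := toRF_injective (h3.trans (map_zero _).symm)
    rcases mul_eq_zero.1 h4 with h | h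
    · exact sub_eq_zero.1 h
    · exact absurd h hQ₀
  obtain ⟨ε, hε0, rfl⟩ := (MvPolynomial.isUnit_iff_eq_C_of_isReduced).1 (IsUnit.of_mul_eq_one_right _ hsq)
  have hren : rename e (P Q) = C ε * P Q := toRF_injective (by rw [map_mul]; exact hc Q)
  -- compare degrees in `k`
  have h1 : (rename e (P Q)).degreeOf k = (P Q).degreeOf k' := by
    have := degreeOf_rename_of_injective (Equiv.injective e) k' (p := P Q)
    rwa [he, Equiv.swap_apply_right] at this
  rw [hren, degreeOf_C_mul _ _ (mem_nonZeroDivisors_of_ne_zero hε0.ne_zero), hk'fresh] at h1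
  exact h1

end Vars

/-! ### The field extension of `ẑ` and the two restriction homomorphisms of the reversed side -/

section HatLam

open MvPolynomial Literature.Probability.LatticeModels.TemperleyLieb

variable (K₀ : Type*) [Field K₀]

/-- **`Ĥ_i`: the field endomorphism extending `hatRename i`** (`z_k ↦ z_{k+2}` for `k ≥ i`). [folklore] -/
noncomputable def genHat (i : ℕ) : RapidityField K₀ →+* RapidityField K₀ :=
  IsFractionRing.lift (g := (toRF K₀).comp (hatRename i)) (toRF_injective.comp (hatRename_injective i))

variable {K₀}

/-- `Ĥ` on polynomials. [folklore] -/
theorem genHat_toRF (i : ℕ) (f : MvPolynomial ℕ K₀) : genHat K₀ i (toRF K₀ f) = toRF K₀ (hatRename i f) :=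
  IsFractionRing.lift_algebraMap _ f

/-- `Ĥ` on the rapidities. [folklore] -/
theorem genHat_genZ (i k : ℕ) : genHat K₀ i (genZ K₀ k) = genZ K₀ (if k < i then k else k + 2) := by
  rw [show genZ K₀ k = toRF K₀ (X k) from rfl, genHat_toRF, hatRename_X]; rfl

/-- `Ĥ` on constants. [folklore] -/
theorem genHat_genC (i : ℕ) (a : K₀) : genHat K₀ i (genC K₀ a) = genC K₀ a := by
  rw [show genC K₀ a = toRF K₀ (C a) from rfl, genHat_toRF, hatRename_C]

/-- `Ĥ` is injective. [folklore] -/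
theorem genHat_injective (i : ℕ) : Function.Injective (genHat K₀ i) := (genHat K₀ i).injective

variable (K₀) in
/-- **`Λ₂`: restriction of the reversed side to `H_1`** — `X_0 ↦ w`, `X_1 ↦ 1/z_1`, `X_2 ↦ 1/(q z_1)`,
`X_k ↦ 1/z_k` (`k ≥ 3`). [folklore] -/
noncomputable def lamTwo (q : K₀) : MvPolynomial ℕ K₀ →+* RapidityField K₀ :=
  eval₂Hom ((toRF K₀).comp C) fun n =>
    if n = 0 then genW K₀ else if n = 2 then (genC K₀ q * genZ K₀ 1)⁻¹ else (genZ K₀ n)⁻¹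

/-- `Λ₂` on variables. [folklore] -/
theorem lamTwo_X (q : K₀) (n : ℕ) :
    lamTwo K₀ q (X n) = if n = 0 then genW K₀ else if n = 2 then (genC K₀ q * genZ K₀ 1)⁻¹ else (genZ K₀ n)⁻¹ := by
  rw [lamTwo, eval₂Hom_X']

/-- `Λ₂` on constants. [folklore] -/
theorem lamTwo_C (q a : K₀) : lamTwo K₀ q (C a) = genC K₀ a := by
  rw [lamTwo, eval₂Hom_C, RingHom.comp_apply]; rfl

variable (K₀) in
/-- **`Λ = Λ₂ ∘ σ_1`**: `X_1 ↦ 1/(q z_1)`, `X_2 ↦ 1/z_1`. [folklore] -/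
noncomputable def lamOne (q : K₀) : MvPolynomial ℕ K₀ →+* RapidityField K₀ :=
  (lamTwo K₀ q).comp (rename (Equiv.swap 1 2)).toRingHom

/-- `Λ` is `Λ₂` after the swap. [folklore] -/
theorem lamOne_apply (q : K₀) (f : MvPolynomial ℕ K₀) : lamOne K₀ q f = lamTwo K₀ q (rename (Equiv.swap 1 2) f) := rfl

/-- `Λ` on variables. [folklore] -/
theorem lamOne_X (q : K₀) (n : ℕ) :
    lamOne K₀ q (X n) = if n = 0 then genW K₀ else if n = 1 then (genC K₀ q * genZ K₀ 1)⁻¹ else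
      if n = 2 then (genZ K₀ 1)⁻¹ else (genZ K₀ n)⁻¹ := by
  rw [lamOne_apply, rename_X, lamTwo_X]
  by_cases h1 : n = 1
  · subst h1; simp [Equiv.swap_apply_left]
  by_cases h2 : n = 2
  · subst h2; simp [Equiv.swap_apply_right]
  rw [Equiv.swap_apply_of_ne_of_ne h1 h2]
  simp [h1, h2]

/-- `Λ` on constants. [folklore] -/
theorem lamOne_C (q a : K₀) : lamOne K₀ q (C a) = genC K₀ a := by
  rw [lamOne_apply, rename_C, lamTwo_C]

/-- **`Λ` kills `X_2 - q X_1`**: `Λ ∘ η = Λ` for the hyperplane substitution `η = hypSubst q 1`. [folklore] -/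
theorem lamOne_hypSubst {q : K₀} (hq : q ≠ 0) (f : MvPolynomial ℕ K₀) : lamOne K₀ q (hypSubst q 1 f) = lamOne K₀ q f := by
  have : (lamOne K₀ q).comp (hypSubst q 1) = lamOne K₀ q := by
    refine ringHom_ext (fun a => ?_) (fun n => ?_)
    · rw [RingHom.comp_apply, hypSubst_C]
    · rw [RingHom.comp_apply, hypSubst_X]
      split_ifs with h
      · subst h
        have hc : genC K₀ q ≠ 0 := toRF_ne_zero_of_eval (fun _ => 1) (by simp [hq])
        have hz := genZ_ne_zero (K₀ := K₀) 1
        rw [map_mul, lamOne_C, lamOne_X, lamOne_X]; simp; field_simp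
      · rfl
  exact RingHom.congr_fun this f

/-- **`Λ ∘ ẑ = Ĥ ∘ ι''`** on polynomials in `X_0, …, X_{2n+1}`. [folklore] -/
theorem lamOne_hatRename {q : K₀} {n : ℕ} {f : MvPolynomial ℕ K₀} (hf : ∀ k, 2 * n + 1 < k → f.degreeOf k = 0) :
    lamOne K₀ q (hatRename 1 f) = genHat K₀ 1 (genInvAll K₀ (2 * n + 1) (toRF K₀ f)) := by
  change ((lamOne K₀ q).comp (hatRename 1)) f = ((genHat K₀ 1).comp ((genInvAll K₀ (2 * n + 1)).comp (toRF K₀))) f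
  refine hom_congr_vars ?_ (fun k hk _ => ?_) rfl
  · refine RingHom.ext fun a => ?_
    simp only [RingHom.comp_apply, hatRename_C, lamOne_C]
    change genC K₀ a = genHat K₀ 1 (genInvAll K₀ (2 * n + 1) (genC K₀ a))
    rw [genInvAll_genC, genHat_genC]
  · have hkL : k ≤ 2 * n + 1 := by
      by_contra h; push Not at h
      exact (mem_vars_iff_degreeOf_ne_zero.1 hk) (hf k h)
    simp only [RingHom.comp_apply]
    change lamOne K₀ q (hatRename 1 (X k)) = genHat K₀ 1 (genInvAll K₀ (2 * n + 1) (genZ K₀ k))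
    rw [hatRename_X, lamOne_X, genInvAll_genZ]
    by_cases hk0 : k = 0
    · subst hk0
      have h1 : (if (0 : ℕ) < 1 then 0 else 0 + 2) = 0 := by simp
      rw [h1, if_pos rfl, if_neg (by omega), genHat_genZ, if_pos (by omega)]; rfl
    · have h1 : (if k < 1 then k else k + 2) = k + 2 := by rw [if_neg (by omega)]
      rw [h1, if_neg (by omega), if_neg (by omega), if_neg (by omega), if_pos ⟨by omega, hkL⟩, map_inv₀,
        genHat_genZ, if_neg (show ¬ k < 1 by omega)]

/-- `toRF ∘ ẑ = Ĥ ∘ toRF`. [folklore] -/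
theorem toRF_hatRename (i : ℕ) (f : MvPolynomial ℕ K₀) : toRF K₀ (hatRename i f) = genHat K₀ i (toRF K₀ f) :=
  (genHat_toRF i f).symm

end HatLam

/-! ### Contracting the duplicated site in the junction -/

section Contract

open Relation

/-- `EqvGen` of a pulled-back reflexive relation along a surjection. [folklore] -/
theorem eqvGen_pullback_iff {α β : Type*} (p : α → β) (hp : Function.Surjective p) (r : β → β → Prop)
    (hr : ∀ b, r b b) (x y : α) : EqvGen (fun x y => r (p x) (p y)) x y ↔ EqvGen r (p x) (p y) := by
  constructor
  · intro h
    induction h with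
    | rel x y h => exact EqvGen.rel _ _ h
    | refl x => exact EqvGen.refl _
    | symm x y _ ih => exact EqvGen.symm _ _ ih
    | trans x y z _ _ ih1 ih2 => exact EqvGen.trans _ _ _ ih1 ih2
  · suffices key : ∀ a b, EqvGen r a b → ∀ x y, p x = a → p y = b → EqvGen (fun x y => r (p x) (p y)) x y from
      fun h => key _ _ h x y rfl rfl
    intro a b h
    induction h with
    | rel a b h => intro x y hx hy; exact EqvGen.rel _ _ (by rw [hx, hy]; exact h)
    | refl a => intro x y hx hy; exact EqvGen.rel _ _ (by rw [hx, hy]; exact hr a)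
    | symm a b _ ih => intro x y hx hy; exact EqvGen.symm _ _ (ih y x hy hx)
    | trans a b c _ _ ih1 ih2 =>
      intro x z hx hz
      obtain ⟨y, hy⟩ := hp b
      exact EqvGen.trans _ _ _ (ih1 x y hx hy) (ih2 y z hy hz)

variable {n : ℕ}

/-- **The junction of two `φ_1`-inserted patterns is the junction of the small patterns**
(marked site = top). [folklore] -/
theorem ipJunction_cpInsDup_zero (R' R : ColPattern n) (hR' : ∀ i, R'.1 i i = true) :
    ipJunction (n + 1) (Fin.last (n + 1)) (cpInsDup 0 R') (cpInsDup 0 R) = ipJunction n (Fin.last n) R' R := by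
  rw [Bool.eq_iff_iff, ipJunction_eq_true_iff, ipJunction_eq_true_iff]
  have hglue : glueRel (cpInsDup 0 R') (cpInsDup 0 R) = fun x y => glueRel R' R ((0 : Fin (n + 1)).predAbove x) ((0 : Fin (n + 1)).predAbove y) := by
    funext x y; simp only [glueRel, cpInsDup_fst]
  have hrefl : ∀ b, glueRel R' R b b := fun b => Or.inl (hR' b)
  rw [hglue]
  constructor
  · rintro ⟨f, hf, hfl⟩
    refine ⟨(0 : Fin (n + 1)).predAbove f, ?_, ?_⟩
    · have := (eqvGen_pullback_iff _ (Fin.predAbove_surjective 0) _ hrefl _ _).1 hf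
      rwa [Fin.predAbove_right_last] at this
    · simpa only [cpInsDup_snd] using hfl
  · rintro ⟨f', hf', hfl'⟩
    obtain ⟨f, rfl⟩ := Fin.predAbove_surjective (0 : Fin (n + 1)) f'
    refine ⟨f, ?_, ?_⟩
    · refine (eqvGen_pullback_iff _ (Fin.predAbove_surjective 0) _ hrefl _ _).2 ?_
      rwa [Fin.predAbove_right_last]
    · simpa only [cpInsDup_snd] using hfl'

/-- Joining the two duplicated sites of `cpInsDup j R` does nothing (`R` valid). [folklore] -/
theorem cpJoin_cpInsDup_self (j : Fin (n + 1)) {R : ColPattern n} (hv : IsValid 0 R) :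
    cpJoin (Fin.castSucc j) j.succ (cpInsDup j R) = cpInsDup j R := by
  have hj1 : j.predAbove (Fin.castSucc j) = j := predAbove_castSucc_self' j
  have hj2 : j.predAbove j.succ = j := predAbove_succ_self' j
  refine Prod.ext (funext fun x => funext fun y => ?_) (funext fun x => ?_)
  · rw [Bool.eq_iff_iff, cpJoin_fst_eq_true_iff]
    simp only [cpInsDup_fst, hj1, hj2]
    constructor
    · rintro (h | ⟨h1, h2⟩ | ⟨h1, h2⟩)
      · exact h
      · exact hv.trans _ _ _ h1 h2
      · exact hv.trans _ _ _ h1 h2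
    · exact fun h => Or.inl h
  · rw [Bool.eq_iff_iff, cpJoin_snd_eq_true_iff]
    simp only [cpInsDup_fst, cpInsDup_snd, hj1, hj2]
    constructor
    · rintro (h | ⟨h1, h2⟩ | ⟨h1, h2⟩)
      · exact h
      · exact hv.wall _ _ (hv.symm _ _ h1) h2
      · exact hv.wall _ _ (hv.symm _ _ h1) h2
    · exact fun h => Or.inl h

/-- `cpInsDup j` of a valid pattern is valid. [folklore] -/
theorem cpInsDup_isValid (j : Fin (n + 1)) {R : ColPattern n} (hv : IsValid 0 R) : IsValid 0 (cpInsDup j R) := by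
  refine ⟨fun i => ?_, fun i k h => ?_, fun i k l h1 h2 => ?_, fun i k h hw => ?_, fun _ => ?_⟩
  · simp only [cpInsDup_fst]; exact hv.refl _
  · simp only [cpInsDup_fst] at h ⊢; exact hv.symm _ _ h
  · simp only [cpInsDup_fst] at h1 h2 ⊢; exact hv.trans _ _ _ h1 h2
  · simp only [cpInsDup_fst, cpInsDup_snd] at h hw ⊢; exact hv.wall _ _ h hw
  · simp only [cpInsDup_snd]
    rw [show j.predAbove 0 = 0 from Fin.predAbove_right_zero]
    exact hv.bottom (by norm_num)

/-- **Gluing against a `φ_1`-inserted pattern is blind to joining the sites `0, 1` on the left**: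
`J(lump (join_{01} Q), φ_1 R) = J(Q, φ_1 R)`. [folklore] -/
theorem ipJunction_right_cpInsDup_zero (j : Fin (n + 2)) {Q : ColPattern (n + 1)} (hQ : IsValid 0 Q) {R : ColPattern n}
    (hR : IsValid 0 R) :
    ipJunction (n + 1) j (lump (cpJoin 0 1 Q)) (cpInsDup 0 R) = ipJunction (n + 1) j Q (cpInsDup 0 R) := by
  rw [ipJunction_lump_left, ipJunction_cpJoin_left_eq_right j 0 1 hQ (cpInsDup_isValid 0 hR)]
  have : cpJoin 0 1 (cpInsDup 0 R) = cpInsDup 0 R := by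
    have h := cpJoin_cpInsDup_self (0 : Fin (n + 1)) hR
    simpa using h
  rw [this]

end Contract


/-! ### The recursion of the pairing on the hyperplane `H_1` -/

section RecursionH1

open MvPolynomial Literature.Probability.LatticeModels.TemperleyLieb

variable {n : ℕ}

/-- Fibre expansion against a kernel: `Σ_{Q'} (Σ_{R : φ R = Q'} a_R) b_{Q'} = Σ_R a_R b_{φ R}`. [folklore] -/
theorem sum_fiber_expand {ι κ M : Type*} [Fintype ι] [Fintype κ] [DecidableEq κ] [CommRing M]
    (φ : ι → κ) (a : ι → M) (b : κ → M) :
    ∑ Q', (∑ R ∈ Finset.univ.filter (fun R => φ R = Q'), a R) * b Q' = ∑ R, a R * b (φ R) := by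
  simp_rw [Finset.sum_mul]
  rw [← Finset.sum_fiberwise_of_maps_to (s := Finset.univ) (t := Finset.univ) (g := φ) (fun _ _ => Finset.mem_univ _)
    (fun R => a R * b (φ R))]
  exact Finset.sum_congr rfl fun Q' _ => Finset.sum_congr rfl fun R hR => by rw [(Finset.mem_filter.1 hR).2]

/-- Fibre sums preserve totals. [folklore] -/
theorem sum_fiber_total {ι κ M : Type*} [Fintype ι] [Fintype κ] [DecidableEq κ] [AddCommMonoid M]
    (φ : ι → κ) (a : ι → M) : ∑ Q', (∑ R ∈ Finset.univ.filter (fun R => φ R = Q'), a R) = ∑ R, a R :=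
  Finset.sum_fiberwise_of_maps_to (fun _ _ => Finset.mem_univ _) _

/-- **`Λ₂(e_1 P) = Λ(P)`**: the exact exchange relation at level `1` restricted through `Λ₂`.
[cite: IkhlefPonsaing2012, Prop. 4.3] -/
theorem lamTwo_push_eq_lamOne {q : ℂ} (hq : q ^ 2 + q + 1 = 0) {P : ColPattern (n + 1) → MvPolynomial ℕ ℂ}
    (hex1 : IsExactExchange q 1 (cpJoin (0 : Fin (n + 2)) 1) (fun Q => toRF ℂ (P Q))) (Q : ColPattern (n + 1)) :
    lamTwo ℂ q (∑ Q₀ ∈ Finset.univ.filter (fun Q₀ => lump (cpJoin 0 1 Q₀) = Q), P Q₀) = lamOne ℂ q (P Q) := by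
  classical
  have hq0 : q ≠ 0 := q_ne_zero_of_quad hq
  set E : MvPolynomial ℕ ℂ := ∑ Q₀ ∈ Finset.univ.filter (fun Q₀ => lump (cpJoin 0 1 Q₀) = Q), P Q₀ with hE
  have hz := genZ_ne_zero (K₀ := ℂ) 1
  have hc : genC ℂ q ≠ 0 := toRF_ne_zero_of_eval (fun _ => 1) (by simp [hq0])
  have hexQ := hex1 Q
  have hD := congrArg (fun x => x * (genC ℂ q * genZ ℂ 1 * genZ ℂ (1 + 1))) hexQ
  simp only at hD
  rw [sub_mul, mul_right_comm, qbr_mul_clear₁ hq0, mul_right_comm, qbr_mul_clear₂, mul_right_comm, qbr_mul_clear₃ hq0,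
    genSwap_toRF, ← map_mul] at hD
  unfold ipPush at hD
  rw [show (∑ Q₀ ∈ Finset.univ.filter (fun Q₀ => lump (cpJoin 0 1 Q₀) = Q), toRF ℂ (P Q₀)) = toRF ℂ E by
    rw [hE, map_sum], ← map_mul, ← map_mul, ← map_sub] at hD
  have hpoly := toRF_injective hD
  rw [show (1 : ℕ) + 1 = 2 from rfl] at hpoly
  have h2 := congrArg (lamTwo ℂ q) hpoly
  rw [map_sub, map_mul (lamTwo ℂ q) (C (q ^ 2) * X 2 ^ 2 - X 1 ^ 2), map_mul (lamTwo ℂ q) (C q * (X 1 ^ 2 - X 2 ^ 2)),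
    map_mul (lamTwo ℂ q) (C (q ^ 2) * X 1 ^ 2 - X 2 ^ 2), ← lamOne_apply] at h2
  have hX1 : lamTwo ℂ q (X 1) = (genZ ℂ 1)⁻¹ := by rw [lamTwo_X]; simp
  have hX2 : lamTwo ℂ q (X 2) = (genC ℂ q * genZ ℂ 1)⁻¹ := by rw [lamTwo_X]; simp
  have hA : lamTwo ℂ q (C (q ^ 2) * X 2 ^ 2 - X 1 ^ 2) = 0 := by
    simp only [map_sub, map_mul, map_pow, lamTwo_C, hX1, hX2]; field_simp; ring
  have hB : lamTwo ℂ q (C q * (X 1 ^ 2 - X 2 ^ 2)) * (genC ℂ q ^ 2 * genZ ℂ 1 ^ 2) = genC ℂ q * (genC ℂ q ^ 2 - 1) := by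
    simp only [map_sub, map_mul, map_pow, lamTwo_C, hX1, hX2]; field_simp
  have hAσ : lamTwo ℂ q (C (q ^ 2) * X 1 ^ 2 - X 2 ^ 2) * (genC ℂ q ^ 2 * genZ ℂ 1 ^ 2) = genC ℂ q ^ 4 - 1 := by
    simp only [map_sub, map_mul, map_pow, lamTwo_C, hX1, hX2]; field_simp
  have hcq : genC ℂ q ^ 2 + genC ℂ q + 1 = 0 := genC_quad hq
  have key : (genC ℂ q - 1) * (lamTwo ℂ q E - lamOne ℂ q (P Q)) = 0 := by
    linear_combination (genC ℂ q ^ 2 * genZ ℂ 1 ^ 2) * h2 - (genC ℂ q ^ 2 * genZ ℂ 1 ^ 2 * lamTwo ℂ q (P Q)) * hA +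
      (lamTwo ℂ q E) * hB + (lamOne ℂ q (P Q)) * hAσ +
      ((genC ℂ q - 1) * lamTwo ℂ q E + genC ℂ q * (genC ℂ q - 1) * lamOne ℂ q (P Q)) * hcq
  have hc1 : genC ℂ q - 1 ≠ 0 := by
    rw [sub_ne_zero]
    unfold genC
    rw [← (toRF ℂ).map_one, ← C_1]
    refine toRF_ne_of_eval (fun _ => 0) ?_
    simp only [eval_C]
    rintro rfl; norm_num at hq
  exact sub_eq_zero.1 ((mul_eq_zero.1 key).resolve_left hc1)

/-- **IP12 Prop. 4.3 in the cluster language, normalisation-free: the pairing restricted to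
`H_1 = {z_2 = q z_1}` is the pairing of the smaller system in the variables `ẑ`.** With
`N_H = Σ Λ₂(P_Q) η(P_{Q'}) J`, `Z_H = Σ η(P_Q)`, `Z^ι_H = Σ Λ₂(P_Q)` (the restrictions to `H_1` of the
numerator, of `Z` and of the transposed `Z`): `N_H · Ĥ(Z'' ι''Z'') = Ĥ(N'') · Z_H · Z^ι_H`.
[cite: IkhlefPonsaing2012, Prop. 4.3] -/
theorem pairing_recursion_H1 {q : ℂ} (hq : q ^ 2 + q + 1 = 0)
    {P : ColPattern (n + 1) → MvPolynomial ℕ ℂ}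
    (hP : ∀ Q', ∑ Q, ipTransferMatrixW (n + 1) (genC ℂ q) (genW ℂ) (genZ ℂ) Q Q' * toRF ℂ (P Q) = toRF ℂ (P Q'))
    (hex1 : IsExactExchange q 1 (cpJoin (0 : Fin (n + 2)) 1) (fun Q => toRF ℂ (P Q)))
    {P'' : ColPattern n → MvPolynomial ℕ ℂ} (hprim'' : PolyPrimitive P'')
    (hP'' : ∀ Q', ∑ Q, ipTransferMatrixW n (genC ℂ q) (genW ℂ) (genZ ℂ) Q Q' * toRF ℂ (P'' Q) = toRF ℂ (P'' Q')) :
    (∑ Q, ∑ Q', lamTwo ℂ q (P Q) * toRF ℂ (hypSubst q 1 (P Q')) *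
        (if ipJunction (n + 1) (Fin.last (n + 1)) Q Q' = true then 1 else 0)) *
      genHat ℂ 1 (ipZsum (fun R => toRF ℂ (P'' R)) * genInvAll ℂ (2 * n + 1) (ipZsum fun R => toRF ℂ (P'' R))) =
    genHat ℂ 1 (ipNpair fun R => toRF ℂ (P'' R)) * (∑ Q', toRF ℂ (hypSubst q 1 (P Q'))) * (∑ Q, lamTwo ℂ q (P Q)) := by
  classical
  have hq0 : q ≠ 0 := q_ne_zero_of_quad hq
  have hP''0 : P'' ≠ 0 := by
    obtain ⟨R₀, hR₀⟩ := hprim''.exists_ne_zero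
    intro h; exact hR₀ (congrFun h R₀)
  -- notation
  set ψ'' : ColPattern n → RapidityField ℂ := fun R => toRF ℂ (P'' R) with hψ''
  set u'' : ColPattern n → RapidityField ℂ := fun R => genInvAll ℂ (2 * n + 1) (ψ'' R) with hu''
  set ψH : ColPattern (n + 1) → RapidityField ℂ := fun Q => toRF ℂ (hypSubst q 1 (P Q)) with hψH
  set Φ : ColPattern (n + 1) → RapidityField ℂ := fun Q =>
    ∑ R ∈ Finset.univ.filter (fun R => cpInsDup 0 R = Q), toRF ℂ (hatRename 1 (P'' R)) with hΦ
  set Φι : ColPattern (n + 1) → RapidityField ℂ := fun Q =>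
    ∑ R ∈ Finset.univ.filter (fun R => cpInsDup 0 R = Q), genHat ℂ 1 (u'' R) with hΦι
  set E : ColPattern (n + 1) → MvPolynomial ℕ ℂ := fun Q =>
    ∑ Q₀ ∈ Finset.univ.filter (fun Q₀ => lump (cpJoin 0 1 Q₀) = Q), P Q₀ with hE
  set JJ : ColPattern (n + 1) → ColPattern (n + 1) → RapidityField ℂ := fun Q Q' =>
    if ipJunction (n + 1) (Fin.last (n + 1)) Q Q' = true then 1 else 0 with hJJ
  -- supports and variables
  have hsuppP : ∀ Q, P Q ≠ 0 → IsValid 0 Q ∧ IsPlanar Q ∧ lump Q = Q := fun Q h =>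
    groundState_support hq hP (Q := Q) fun h0 => h (toRF_injective (h0.trans (map_zero _).symm))
  have hsupp'' : ∀ R, P'' R ≠ 0 → IsValid 0 R ∧ IsPlanar R ∧ lump R = R := fun R h =>
    groundState_support hq hP'' (Q := R) fun h0 => h (toRF_injective (h0.trans (map_zero _).symm))
  have hvars'' : ∀ R k, 2 * n + 1 < k → (P'' R).degreeOf k = 0 := fun R k hk =>
    primitive_fixed_degreeOf_eq_zero hq hprim'' hP'' hk R
  -- (i) the factorisation on `H_1`
  have hΦ0 : Φ ≠ 0 := by
    have := pushforward_cpInsDup_ne_zero hq (0 : Fin (n + 1)) hP''0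
    simp only [Fin.val_zero, mul_zero, zero_add] at this
    exact this
  obtain ⟨k₀, hk₀⟩ : ∃ k₀, Φ k₀ ≠ 0 := by by_contra h; push Not at h; exact hΦ0 (funext h)
  have hprop : ∀ Q', Φ k₀ * ψH Q' = ψH k₀ * Φ Q' := by
    intro Q'
    have := groundState_hyp_recursion_odd hq (0 : Fin (n + 1)) hP hP'' k₀
    simp only [Fin.val_zero, mul_zero, zero_add] at this
    have h := congrFun this Q'
    simp only [Pi.smul_apply, smul_eq_mul] at h
    exact h
  have hΦhat : ∀ Q, Φ Q = genHat ℂ 1 (∑ R ∈ Finset.univ.filter (fun R => cpInsDup 0 R = Q), ψ'' R) := by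
    intro Q; rw [hΦ, map_sum]; simp only [toRF_hatRename]; rfl
  have hΦι_lam : ∀ Q, lamOne ℂ q (∑ R ∈ Finset.univ.filter (fun R => cpInsDup 0 R = Q), hatRename 1 (P'' R)) = Φι Q := by
    intro Q; rw [map_sum, hΦι]
    exact Finset.sum_congr rfl fun R _ => lamOne_hatRename (hvars'' R)
  have hΦιhat : ∀ Q, Φι Q = genHat ℂ 1 (genInvAll ℂ (2 * n + 1) (∑ R ∈ Finset.univ.filter (fun R => cpInsDup 0 R = Q), ψ'' R)) := by
    intro Q; rw [hΦι, map_sum, map_sum]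
  have hδ : Φι k₀ ≠ 0 := by
    rw [hΦιhat]
    intro h
    apply hk₀
    rw [hΦhat, (genInvAll_injective (2 * n + 1)) ((genHat_injective 1 (h.trans (map_zero _).symm)).trans (map_zero _).symm),
      map_zero]
  -- (i) transported by `Λ`
  have hfacP : ∀ Q', hypSubst q 1 (P Q') * (∑ R ∈ Finset.univ.filter (fun R => cpInsDup 0 R = k₀), hatRename 1 (P'' R)) =
      hypSubst q 1 (P k₀) * (∑ R ∈ Finset.univ.filter (fun R => cpInsDup 0 R = Q'), hatRename 1 (P'' R)) := by
    intro Q'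
    apply toRF_injective
    rw [map_mul, map_mul, map_sum, map_sum]
    have := hprop Q'
    rw [hΦ, hψH] at this
    simp only at this
    linear_combination this
  have hlam : ∀ Q', lamOne ℂ q (P Q') * Φι k₀ = lamOne ℂ q (hypSubst q 1 (P k₀)) * Φι Q' := by
    intro Q'
    have := congrArg (lamOne ℂ q) (hfacP Q')
    rw [map_mul, map_mul, lamOne_hypSubst hq0, hΦι_lam, hΦι_lam] at this
    exact this
  -- (ii) the exchange relation through `Λ₂`
  have hlamE : ∀ Q, lamTwo ℂ q (E Q) = lamOne ℂ q (P Q) := fun Q => lamTwo_push_eq_lamOne hq hex1 Q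
  -- the four scalars
  set α := ψH k₀ with hα
  set β := Φ k₀ with hβ
  set γ := lamOne ℂ q (hypSubst q 1 (P k₀)) with hγ
  set δ := Φι k₀ with hδdef
  -- (a) Z_H β = α Ĥ(Z'')
  have ha : (∑ Q', ψH Q') * β = α * genHat ℂ 1 (ipZsum ψ'') := by
    rw [Finset.sum_mul, Finset.sum_congr rfl fun Q' _ => show ψH Q' * β = α * Φ Q' by rw [mul_comm]; exact hprop Q',
      ← Finset.mul_sum]
    congr 1
    unfold ipZsum; rw [Finset.sum_congr rfl fun Q _ => hΦhat Q, ← map_sum, sum_fiber_total]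
  -- (b) Zι_H δ = γ Ĥ(ι'' Z'')
  have hb : (∑ Q, lamTwo ℂ q (P Q)) * δ = γ * genHat ℂ 1 (genInvAll ℂ (2 * n + 1) (ipZsum ψ'')) := by
    have h1 : ∑ Q, lamTwo ℂ q (P Q) = ∑ Q₀, lamOne ℂ q (P Q₀) := by
      rw [← Finset.sum_congr rfl fun Q₀ _ => hlamE Q₀]
      simp only [hE, map_sum]
      exact (sum_fiber_total (fun Q₀ => lump (cpJoin 0 1 Q₀)) fun Q => lamTwo ℂ q (P Q)).symm
    rw [h1, Finset.sum_mul, Finset.sum_congr rfl fun Q₀ _ => hlam Q₀, ← Finset.mul_sum]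
    congr 1
    unfold ipZsum; rw [map_sum, map_sum, Finset.sum_congr rfl fun Q _ => hΦιhat Q]
    simp only [map_sum]
    rw [sum_fiber_total]
  -- (c) N_H β δ = α γ Ĥ(N'')
  have hc : (∑ Q, ∑ Q', lamTwo ℂ q (P Q) * ψH Q' * JJ Q Q') * β * δ = α * γ * genHat ℂ 1 (ipNpair ψ'') := by
    -- e1: expand `ψH` through `Φ` and swap the sums
    have e1 : (∑ Q, ∑ Q', lamTwo ℂ q (P Q) * ψH Q' * JJ Q Q') * β =
        α * ∑ R, genHat ℂ 1 (ψ'' R) * ∑ Q, lamTwo ℂ q (P Q) * JJ Q (cpInsDup 0 R) := by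
      have h1 : ∀ Q, (∑ Q', lamTwo ℂ q (P Q) * ψH Q' * JJ Q Q') * β =
          α * (lamTwo ℂ q (P Q) * ∑ R, genHat ℂ 1 (ψ'' R) * JJ Q (cpInsDup 0 R)) := by
        intro Q
        have h2 : ∀ Q', lamTwo ℂ q (P Q) * ψH Q' * JJ Q Q' * β = α * (lamTwo ℂ q (P Q) * (Φ Q' * JJ Q Q')) := by
          intro Q'; have := hprop Q'; linear_combination (lamTwo ℂ q (P Q) * JJ Q Q') * this
        rw [Finset.sum_mul, Finset.sum_congr rfl fun Q' _ => h2 Q', ← Finset.mul_sum, ← Finset.mul_sum]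
        congr 2
        simp only [hΦ, toRF_hatRename]
        exact sum_fiber_expand (fun R => cpInsDup 0 R) (fun R => genHat ℂ 1 (ψ'' R)) (JJ Q)
      rw [Finset.sum_mul, Finset.sum_congr rfl fun Q _ => h1 Q, ← Finset.mul_sum]
      congr 1
      simp_rw [Finset.mul_sum]
      rw [Finset.sum_comm]
      exact Finset.sum_congr rfl fun R _ => Finset.sum_congr rfl fun Q _ => by ring
    -- e2: for each `R`, the `e_1`-regrouping, (ii), (i) and the contraction
    have e2 : ∀ R, genHat ℂ 1 (ψ'' R) * (∑ Q, lamTwo ℂ q (P Q) * JJ Q (cpInsDup 0 R)) * δ =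
        genHat ℂ 1 (ψ'' R) * (γ * ∑ R', genHat ℂ 1 (u'' R') * (if ipJunction n (Fin.last n) R' R = true then 1 else 0)) := by
      intro R
      by_cases hR : ψ'' R = 0
      · rw [hR, map_zero, zero_mul, zero_mul, zero_mul]
      have hRv : IsValid 0 R := (hsupp'' R fun h => hR (by rw [hψ'']; simp [h])).1
      rw [mul_assoc]
      congr 1
      -- gluing lemma
      have hglue : ∀ Q, lamTwo ℂ q (P Q) * JJ Q (cpInsDup 0 R) = lamTwo ℂ q (P Q) * JJ (lump (cpJoin 0 1 Q)) (cpInsDup 0 R) := by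
        intro Q
        by_cases hPQ : P Q = 0
        · rw [hPQ, map_zero, zero_mul, zero_mul]
        · rw [hJJ]; simp only; rw [ipJunction_right_cpInsDup_zero _ (hsuppP Q hPQ).1 hRv]
      -- regroup along the fibres of `e_1` and use (ii)
      have hreg : ∑ Q, lamTwo ℂ q (P Q) * JJ Q (cpInsDup 0 R) = ∑ Q₀, lamOne ℂ q (P Q₀) * JJ Q₀ (cpInsDup 0 R) := by
        rw [Finset.sum_congr rfl fun Q _ => hglue Q,
          ← sum_fiber_expand (fun Q => lump (cpJoin 0 1 Q)) (fun Q => lamTwo ℂ q (P Q)) (fun Q₀ => JJ Q₀ (cpInsDup 0 R))]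
        refine Finset.sum_congr rfl fun Q₀ _ => ?_
        rw [← hlamE Q₀, hE]; simp only [map_sum]
      -- (i) and the contraction
      have hstep : ∀ Q₀, lamOne ℂ q (P Q₀) * JJ Q₀ (cpInsDup 0 R) * δ = γ * (Φι Q₀ * JJ Q₀ (cpInsDup 0 R)) := by
        intro Q₀; have := hlam Q₀; rw [hδdef]; linear_combination (JJ Q₀ (cpInsDup 0 R)) * this
      rw [hreg, Finset.sum_mul, Finset.sum_congr rfl fun Q₀ _ => hstep Q₀, ← Finset.mul_sum]
      congr 1
      rw [Finset.sum_congr rfl fun Q₀ _ => by rw [hΦι],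
        sum_fiber_expand (fun R' => cpInsDup 0 R') (fun R' => genHat ℂ 1 (u'' R')) (fun Q₀ => JJ Q₀ (cpInsDup 0 R))]
      refine Finset.sum_congr rfl fun R' _ => ?_
      by_cases hR' : ψ'' R' = 0
      · have : u'' R' = 0 := by rw [hu'']; simp [hR']
        rw [this, map_zero, zero_mul, zero_mul]
      · have hR'v : IsValid 0 R' := (hsupp'' R' fun h => hR' (by rw [hψ'']; simp [h])).1
        rw [hJJ]; simp only; rw [ipJunction_cpInsDup_zero R' R hR'v.refl]
    -- e3: the small numerator
    have e3 : genHat ℂ 1 (ipNpair ψ'') =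
        ∑ R, ∑ R', genHat ℂ 1 (ψ'' R) * genHat ℂ 1 (u'' R') * (if ipJunction n (Fin.last n) R' R = true then 1 else 0) := by
      unfold ipNpair
      rw [map_sum, Finset.sum_comm]
      refine Finset.sum_congr rfl fun R _ => ?_
      rw [map_sum]
      refine Finset.sum_congr rfl fun R' _ => ?_
      rw [hu'', map_mul, map_mul]
      split_ifs <;> simp; ring
    calc (∑ Q, ∑ Q', lamTwo ℂ q (P Q) * ψH Q' * JJ Q Q') * β * δ
        = (α * ∑ R, genHat ℂ 1 (ψ'' R) * ∑ Q, lamTwo ℂ q (P Q) * JJ Q (cpInsDup 0 R)) * δ := by rw [e1]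
      _ = α * ∑ R, genHat ℂ 1 (ψ'' R) * (∑ Q, lamTwo ℂ q (P Q) * JJ Q (cpInsDup 0 R)) * δ := by
          rw [mul_assoc, Finset.sum_mul]
      _ = α * ∑ R, genHat ℂ 1 (ψ'' R) * (γ * ∑ R', genHat ℂ 1 (u'' R') *
            (if ipJunction n (Fin.last n) R' R = true then 1 else 0)) := by rw [Finset.sum_congr rfl fun R _ => e2 R]
      _ = α * γ * genHat ℂ 1 (ipNpair ψ'') := by
          have h : ∀ R, genHat ℂ 1 (ψ'' R) * (γ * ∑ R', genHat ℂ 1 (u'' R') *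
              (if ipJunction n (Fin.last n) R' R = true then 1 else 0)) =
              γ * ∑ R', genHat ℂ 1 (ψ'' R) * genHat ℂ 1 (u'' R') * (if ipJunction n (Fin.last n) R' R = true then 1 else 0) := by
            intro R
            rw [Finset.mul_sum, Finset.mul_sum, Finset.mul_sum]
            exact Finset.sum_congr rfl fun R' _ => by ring
          rw [Finset.sum_congr rfl fun R _ => h R, ← Finset.mul_sum, e3]; ring
  -- (d) conclude
  have hβ0 : β ≠ 0 := hk₀
  apply mul_right_cancel₀ (mul_ne_zero hβ0 hδ)
  rw [map_mul]
  have hc' := hc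
  simp only [hJJ] at hc'
  linear_combination (genHat ℂ 1 (ipZsum ψ'') * genHat ℂ 1 (genInvAll ℂ (2 * n + 1) (ipZsum ψ''))) * hc' -
    (genHat ℂ 1 (ipNpair ψ'') * ((∑ Q, lamTwo ℂ q (P Q)) * δ)) * ha -
    (genHat ℂ 1 (ipNpair ψ'') * α * genHat ℂ 1 (ipZsum ψ'')) * hb

end RecursionH1

end Literature.Probability.Percolation
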